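import Summits.BirchSwinnertonDyer.BirchSwinnertonDyer.Theorems.PrintCf2RubinValueTwoFourTermMuDefect
import Literature.NumberTheory.EllipticCurves.IwasawaAlgebraLengthAwayComparisonProofs
import Literature.NumberTheory.IwasawaTheory.IwasawaAlgebraTwoVarRegularProofs
import HarnessLib

/-!
# Over `Λ₂ = ℤ_p⟦T₂⟧⟦T₁⟧`: length (in)equalities at the height-one primes NOT CONTAINING `p` ⟹ the `⊗ℚ` class-group
# hypothesis `ha : ∃ i i', char M · (p)^i = char N · (p)^{i'}` of the (Q)-socket (resp. its one-sided half)

Cell `bsd-print-cf2` (HOME `run/shared/lean/pub/bsd-print-cf2/`), width seat `bsd-line-cf2c-w3` g7; planner g20 RULING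
R-ABRICK item **(γ3)** (PLAN §5 v1.74, 2026-08-29) for the DECIDING research child stmt-BirchSwinnertonDyer-24721
`PrintCf2RubinValueTwo.MainConjClauseAtSplitTwoQuadDA` (M-LINE-PIN stub (Q) `stub_powForm`, socket
`ClassGroupQuotient.powForm_of_dualInvariants_rat`, hypothesis `ha`). The printed sources of the class-group half at
`p = 2` — Kato 2004 Astérisque 295 Thm. 15.2 (1)(a) (`length(𝔥²)_𝔮 ≤ length(𝔥¹/ℨ)_𝔮` at every height-one `𝔮 ∌ p`,
typed as `Kato2004.EllipticUnitTower.Thm152aShape`) and Johnson-Leung–Kings 2011 Thm. 5.2 ⊗ ℚ — are families of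
LENGTH (in)equalities away from `p`; the socket consumes the identity of characteristic ideals UP TO POWERS OF `(p)`. In
`Λ₂` (a Noetherian domain in which `p` is a prime element, `FourTerm.prime_natCast_iwasawaAlgebra₂`) the only height-one
prime containing `p` is `(p)`, so the generic dictionary of
`Literature/NumberTheory/EllipticCurves/IwasawaAlgebraLengthAwayComparisonProofs.lean` applies verbatim:

* **`exists_charIdeal_mul_span_pow_eq_of_lengthAt_eq_two`** — equal lengths at every height-one `𝔮 ∌ p` ⟹
  `∃ i i', char M · (p)^i = char N · (p)^{i'}` = `ha` VERBATIM (with `C.X := M`, `Q := N`);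
* **`exists_charIdeal_dvd_mul_span_pow_of_lengthAt_le_two`** / `exists_mul_span_pow_le_charIdeal_of_lengthAt_le_two` —
  `length M_𝔮 ≤ length N_𝔮` at every height-one `𝔮 ∌ p` ⟹ `∃ k, char M ∣ char N · (p)^k` (resp. `char N · (p)^k ⊆ char M`)
  = the one-sided (γ) half «char C.X ∣ char Q · 2^k»;
* `charIdeal_mul_span_pow_eq_of_lengthAt_eq_two`, `charIdeal_dvd_mul_span_pow_of_lengthAt_le_two` — the same with the
  explicit exponents `length (·)_{(p)}` (the `μ`-invariants at `(p)`);
* (appended) the CONVERSES / `iff` forms over `Λ₂` (a UFD, `uniqueFactorizationMonoid_iwasawaAlgebraTwoVar`):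
  `exists_charIdeal_mul_span_pow_eq_iff_lengthAt_eq_two`, `exists_charIdeal_dvd_mul_span_pow_iff_lengthAt_le_two`.

THEOREMS ONLY (no `def`, no named fact, no `sorry`); Theses-free; generic in the prime `p` and the modules. BSD is not
proved by any of this; nothing here closes the crux (`--supports` helper). beyond-print theorem: no.

References: K. Kato, Astérisque 295 (2004) Thm. 15.2 (1)(a), p. 251 / p. 255 [Kato2004Asterisque]; J. Johnson-Leung,
G. Kings, J. reine angew. Math. 653 (2011) Thm. 5.2, §5.4 [JohnsonLeungKings2011]; Neukirch–Schmidt–Wingberg V §3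
(5.3.9)–(5.3.10) [NeukirchSchmidtWingberg2008].
-/

noncomputable section

set_option linter.dupNamespace false -- D-0017: single-problem summit, `…BirchSwinnertonDyer.BirchSwinnertonDyer…` repeats a namespace by design
set_option autoImplicit false

namespace Summit.BirchSwinnertonDyer.BirchSwinnertonDyer.Theorems.PrintCf2.FourTerm

open Literature.NumberTheory.EllipticCurves

universe u₁ u₂

variable {p : ℕ} [Fact p.Prime] {M : Type u₁} [AddCommGroup M] [Module (IwasawaAlgebra₂ p) M]
  {N : Type u₂} [AddCommGroup N] [Module (IwasawaAlgebra₂ p) N]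

/-- **Equal lengths at every height-one prime of `Λ₂` not containing `p` ⟹ `char M · (p)^{μ(N)} = char N · (p)^{μ(M)}`**
(`μ(·)` = the local length at the height-one prime `(p)`), for finitely generated torsion `Λ₂`-modules `M`, `N`.
[cite: NeukirchSchmidtWingberg2008, Ch. V §3, (5.3.9)–(5.3.10)] [cite: Kato2004Asterisque, Thm. 15.2 (1)(a) p. 251 (the length currency)] -/
theorem charIdeal_mul_span_pow_eq_of_lengthAt_eq_two [Module.Finite (IwasawaAlgebra₂ p) M]
    [Module.Finite (IwasawaAlgebra₂ p) N] (hM : Module.IsTorsion (IwasawaAlgebra₂ p) M)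
    (hN : Module.IsTorsion (IwasawaAlgebra₂ p) N)
    (h : ∀ 𝔮 : PrimeSpectrum (IwasawaAlgebra₂ p), 𝔮.asIdeal.height = 1 → ((p : ℕ) : IwasawaAlgebra₂ p) ∉ 𝔮.asIdeal →
      Module.lengthAt (IwasawaAlgebra₂ p) M 𝔮 = Module.lengthAt (IwasawaAlgebra₂ p) N 𝔮) :
    Module.charIdeal (IwasawaAlgebra₂ p) M * Ideal.span {((p : ℕ) : IwasawaAlgebra₂ p)} ^
        (Module.lengthAt (IwasawaAlgebra₂ p) N ⟨Ideal.span {((p : ℕ) : IwasawaAlgebra₂ p)},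
          (Ideal.span_singleton_prime prime_natCast_iwasawaAlgebra₂.ne_zero).mpr prime_natCast_iwasawaAlgebra₂⟩).toNat =
      Module.charIdeal (IwasawaAlgebra₂ p) N * Ideal.span {((p : ℕ) : IwasawaAlgebra₂ p)} ^
        (Module.lengthAt (IwasawaAlgebra₂ p) M ⟨Ideal.span {((p : ℕ) : IwasawaAlgebra₂ p)},
          (Ideal.span_singleton_prime prime_natCast_iwasawaAlgebra₂.ne_zero).mpr prime_natCast_iwasawaAlgebra₂⟩).toNat :=
  Module.charIdeal_mul_span_pow_eq_of_lengthAt_eq hM hN prime_natCast_iwasawaAlgebra₂ h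

/-- **(γ3), EQUALITY FORM = the socket's `ha` VERBATIM**: for finitely generated torsion `Λ₂`-modules `M`, `N` with
`length M_𝔮 = length N_𝔮` at every height-one prime `𝔮 ∌ p`, `∃ i i', char M · (p)^i = char N · (p)^{i'}` (feed
`M := C.X`, `N := Q` to `ClassGroupQuotient.powForm_of_dualInvariants_rat`).
[cite: NeukirchSchmidtWingberg2008, Ch. V §3, (5.3.9)–(5.3.10)] [cite: JohnsonLeungKings2011, Thm. 5.2, §5.4] -/
theorem exists_charIdeal_mul_span_pow_eq_of_lengthAt_eq_two [Module.Finite (IwasawaAlgebra₂ p) M]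
    [Module.Finite (IwasawaAlgebra₂ p) N] (hM : Module.IsTorsion (IwasawaAlgebra₂ p) M)
    (hN : Module.IsTorsion (IwasawaAlgebra₂ p) N)
    (h : ∀ 𝔮 : PrimeSpectrum (IwasawaAlgebra₂ p), 𝔮.asIdeal.height = 1 → ((p : ℕ) : IwasawaAlgebra₂ p) ∉ 𝔮.asIdeal →
      Module.lengthAt (IwasawaAlgebra₂ p) M 𝔮 = Module.lengthAt (IwasawaAlgebra₂ p) N 𝔮) :
    ∃ i i' : ℕ, Module.charIdeal (IwasawaAlgebra₂ p) M * Ideal.span {((p : ℕ) : IwasawaAlgebra₂ p)} ^ i =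
      Module.charIdeal (IwasawaAlgebra₂ p) N * Ideal.span {((p : ℕ) : IwasawaAlgebra₂ p)} ^ i' :=
  Module.exists_charIdeal_mul_span_pow_eq_of_lengthAt_eq hM hN prime_natCast_iwasawaAlgebra₂ h

/-- **Smaller lengths at every height-one prime of `Λ₂` not containing `p` ⟹ `char M ∣ char N · (p)^{μ(M)}`** for
finitely generated torsion `Λ₂`-modules `M`, `N`. [cite: NeukirchSchmidtWingberg2008, Ch. V §3, (5.3.9)–(5.3.10)]
[cite: Kato2004Asterisque, Thm. 15.2 (1)(a) p. 251] -/
theorem charIdeal_dvd_mul_span_pow_of_lengthAt_le_two [Module.Finite (IwasawaAlgebra₂ p) M]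
    [Module.Finite (IwasawaAlgebra₂ p) N] (hM : Module.IsTorsion (IwasawaAlgebra₂ p) M)
    (hN : Module.IsTorsion (IwasawaAlgebra₂ p) N)
    (h : ∀ 𝔮 : PrimeSpectrum (IwasawaAlgebra₂ p), 𝔮.asIdeal.height = 1 → ((p : ℕ) : IwasawaAlgebra₂ p) ∉ 𝔮.asIdeal →
      Module.lengthAt (IwasawaAlgebra₂ p) M 𝔮 ≤ Module.lengthAt (IwasawaAlgebra₂ p) N 𝔮) :
    Module.charIdeal (IwasawaAlgebra₂ p) M ∣
      Module.charIdeal (IwasawaAlgebra₂ p) N * Ideal.span {((p : ℕ) : IwasawaAlgebra₂ p)} ^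
        (Module.lengthAt (IwasawaAlgebra₂ p) M ⟨Ideal.span {((p : ℕ) : IwasawaAlgebra₂ p)},
          (Ideal.span_singleton_prime prime_natCast_iwasawaAlgebra₂.ne_zero).mpr prime_natCast_iwasawaAlgebra₂⟩).toNat :=
  Module.charIdeal_dvd_mul_span_pow_of_lengthAt_le hM hN prime_natCast_iwasawaAlgebra₂ h

/-- **(γ3), ONE-SIDED FORM «`char M ∣ char N · p^k`»**: for finitely generated torsion `Λ₂`-modules `M`, `N` with
`length M_𝔮 ≤ length N_𝔮` at every height-one prime `𝔮 ∌ p` (the shape of Kato's Thm. 15.2 (1)(a) with `M := 𝔥²`,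
`N := 𝔥¹/ℨ`), `∃ k, char M ∣ char N · (p)^k`. [cite: Kato2004Asterisque, Thm. 15.2 (1)(a) p. 251]
[cite: NeukirchSchmidtWingberg2008, Ch. V §3, (5.3.9)–(5.3.10)] -/
theorem exists_charIdeal_dvd_mul_span_pow_of_lengthAt_le_two [Module.Finite (IwasawaAlgebra₂ p) M]
    [Module.Finite (IwasawaAlgebra₂ p) N] (hM : Module.IsTorsion (IwasawaAlgebra₂ p) M)
    (hN : Module.IsTorsion (IwasawaAlgebra₂ p) N)
    (h : ∀ 𝔮 : PrimeSpectrum (IwasawaAlgebra₂ p), 𝔮.asIdeal.height = 1 → ((p : ℕ) : IwasawaAlgebra₂ p) ∉ 𝔮.asIdeal →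
      Module.lengthAt (IwasawaAlgebra₂ p) M 𝔮 ≤ Module.lengthAt (IwasawaAlgebra₂ p) N 𝔮) :
    ∃ k : ℕ, Module.charIdeal (IwasawaAlgebra₂ p) M ∣
      Module.charIdeal (IwasawaAlgebra₂ p) N * Ideal.span {((p : ℕ) : IwasawaAlgebra₂ p)} ^ k :=
  Module.exists_charIdeal_dvd_mul_span_pow_of_lengthAt_le hM hN prime_natCast_iwasawaAlgebra₂ h

/-- **(γ3), ONE-SIDED FORM as a containment «`char N · (p)^k ⊆ char M`»** for finitely generated torsion `Λ₂`-modules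
with `length M_𝔮 ≤ length N_𝔮` at every height-one `𝔮 ∌ p`. [cite: Kato2004Asterisque, Thm. 15.2 (1)(a) p. 251]
[cite: NeukirchSchmidtWingberg2008, Ch. V §3, (5.3.9)–(5.3.10)] -/
theorem exists_mul_span_pow_le_charIdeal_of_lengthAt_le_two [Module.Finite (IwasawaAlgebra₂ p) M]
    [Module.Finite (IwasawaAlgebra₂ p) N] (hM : Module.IsTorsion (IwasawaAlgebra₂ p) M)
    (hN : Module.IsTorsion (IwasawaAlgebra₂ p) N)
    (h : ∀ 𝔮 : PrimeSpectrum (IwasawaAlgebra₂ p), 𝔮.asIdeal.height = 1 → ((p : ℕ) : IwasawaAlgebra₂ p) ∉ 𝔮.asIdeal →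
      Module.lengthAt (IwasawaAlgebra₂ p) M 𝔮 ≤ Module.lengthAt (IwasawaAlgebra₂ p) N 𝔮) :
    ∃ k : ℕ, Module.charIdeal (IwasawaAlgebra₂ p) N * Ideal.span {((p : ℕ) : IwasawaAlgebra₂ p)} ^ k ≤
      Module.charIdeal (IwasawaAlgebra₂ p) M :=
  Module.exists_mul_span_pow_le_charIdeal_of_lengthAt_le hM hN prime_natCast_iwasawaAlgebra₂ h

/-! ## Appended: the `iff` forms over `Λ₂` (both directions, planner g20 11:31Z) -/

/-- **Over `Λ₂`: `∃ i i', char M · (p)^i = char N · (p)^{i'}` ⟺ `length M_𝔮 = length N_𝔮` at every height-one `𝔮 ∌ p`**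
(`M`, `N` finitely generated torsion; `Λ₂` is a Noetherian UFD, `uniqueFactorizationMonoid_iwasawaAlgebraTwoVar`).
[cite: NeukirchSchmidtWingberg2008, Ch. V §3, (5.3.9)–(5.3.10)] [cite: JohnsonLeungKings2011, Thm. 5.2, §5.4] -/
theorem exists_charIdeal_mul_span_pow_eq_iff_lengthAt_eq_two [Module.Finite (IwasawaAlgebra₂ p) M]
    [Module.Finite (IwasawaAlgebra₂ p) N] (hM : Module.IsTorsion (IwasawaAlgebra₂ p) M)
    (hN : Module.IsTorsion (IwasawaAlgebra₂ p) N) :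
    (∃ i i' : ℕ, Module.charIdeal (IwasawaAlgebra₂ p) M * Ideal.span {((p : ℕ) : IwasawaAlgebra₂ p)} ^ i =
        Module.charIdeal (IwasawaAlgebra₂ p) N * Ideal.span {((p : ℕ) : IwasawaAlgebra₂ p)} ^ i') ↔
      ∀ 𝔮 : PrimeSpectrum (IwasawaAlgebra₂ p), 𝔮.asIdeal.height = 1 → ((p : ℕ) : IwasawaAlgebra₂ p) ∉ 𝔮.asIdeal →
        Module.lengthAt (IwasawaAlgebra₂ p) M 𝔮 = Module.lengthAt (IwasawaAlgebra₂ p) N 𝔮 := by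
  haveI : UniqueFactorizationMonoid (IwasawaAlgebra₂ p) :=
    Literature.NumberTheory.IwasawaTheory.uniqueFactorizationMonoid_iwasawaAlgebraTwoVar p
  exact Module.exists_charIdeal_mul_span_pow_eq_iff_lengthAt_eq hM hN prime_natCast_iwasawaAlgebra₂

/-- **Over `Λ₂`: `∃ k, char M ∣ char N · (p)^k` ⟺ `length M_𝔮 ≤ length N_𝔮` at every height-one `𝔮 ∌ p`** (`M`, `N`
finitely generated torsion) — the one-sided half in the currency of Kato's Thm. 15.2 (1)(a).
[cite: Kato2004Asterisque, Thm. 15.2 (1)(a) p. 251] [cite: NeukirchSchmidtWingberg2008, Ch. V §3, (5.3.9)–(5.3.10)] -/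
theorem exists_charIdeal_dvd_mul_span_pow_iff_lengthAt_le_two [Module.Finite (IwasawaAlgebra₂ p) M]
    [Module.Finite (IwasawaAlgebra₂ p) N] (hM : Module.IsTorsion (IwasawaAlgebra₂ p) M)
    (hN : Module.IsTorsion (IwasawaAlgebra₂ p) N) :
    (∃ k : ℕ, Module.charIdeal (IwasawaAlgebra₂ p) M ∣
        Module.charIdeal (IwasawaAlgebra₂ p) N * Ideal.span {((p : ℕ) : IwasawaAlgebra₂ p)} ^ k) ↔
      ∀ 𝔮 : PrimeSpectrum (IwasawaAlgebra₂ p), 𝔮.asIdeal.height = 1 → ((p : ℕ) : IwasawaAlgebra₂ p) ∉ 𝔮.asIdeal →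
        Module.lengthAt (IwasawaAlgebra₂ p) M 𝔮 ≤ Module.lengthAt (IwasawaAlgebra₂ p) N 𝔮 := by
  haveI : UniqueFactorizationMonoid (IwasawaAlgebra₂ p) :=
    Literature.NumberTheory.IwasawaTheory.uniqueFactorizationMonoid_iwasawaAlgebraTwoVar p
  exact Module.exists_charIdeal_dvd_mul_span_pow_iff_lengthAt_le hM hN prime_natCast_iwasawaAlgebra₂

end Summit.BirchSwinnertonDyer.BirchSwinnertonDyer.Theorems.PrintCf2.FourTerm

end
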